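import Summits.BirchSwinnertonDyer.BirchSwinnertonDyer.Theorems.ShaPrimaryTransferFiniteShaComponentTransferBaseChangeOddDoor
import Literature.NumberTheory.EllipticCurves.ShaPTorsionQuadraticSplitting
import HarnessLib

/-!
# BirchSwinnertonDyer / ShaPrimaryTransfer — crux `FiniteShaComponentTransfer` (stmt-BirchSwinnertonDyer-22356):
# ONE `q`-DESCENT OVER A QUADRATIC FIELD IS TWO `q`-DESCENTS OVER `ℚ` (odd `q`) — instrument readings

Helper file of prover seat `bsd-line-spt-p1` g14 (`--supports stmt-22356 --as helper`). THEOREMS ONLY (no definition,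
no named fact, no `sorry`, no instance). The route's cross-prime instrument certifies the hypothesis `t_p(E) = 0` and the
conclusion `t_q(E) = 0` of T = `FiniteShaComponentTransfer` curve by curve, by complete descents; several of its
descents run over a quadratic field `K` (Eisenstein field for `3`-isogeny Kummer descents, Heegner fields). This file
turns the tree's finiteness-free splitting `#Ш(E_K)[q] = #Ш(E)[q] · #Ш(E^{(d_K)})[q]` for odd `q`
(`Literature/…/ShaPTorsionQuadraticSplitting`, g14) and `t_q(E_K) = t_q(E) + t_q(E^{(d_K)})` (`…BaseChange`, g14) into
route currency:

* §1 a CLOSED first `q`-descent over `K` (`#Ш(E_K)[q] = 1`, `q` odd) is two closed first descents over `ℚ`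
  (`Ш(E)[q] = 0`, `Ш(E^{(d_K)})[q] = 0`) and closes both `ℚ`-doors at `q`; conversely two closed `ℚ`-descents close the
  one over `K`; `#Ш(E_K)[q] ≠ 1` iff one of the two `ℚ`-defects is `≠ 1`.
* §2 defects read as exponents: `#Ш(E)[q] = q^a`, `#Ш(E^{(d_K)})[q] = q^b` ⟹ `#Ш(E_K)[q] = q^{a+b}` and (odd door over `ℚ`
  twice) `t_q(E) ≡ a`, `t_q(E^{(d_K)}) ≡ b (mod 2)`, so `t_q(E_K) ≡ a + b`: a defect over `K` of ODD exponent locates an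
  infinite `Ш[q^∞]` over `ℚ` on the side with the odd exponent.
* §3 route readings: granting T, a closed door of `E` at `p` and of `E^{(d_K)}` at `p'` make every odd-`q` defect of
  `E_K` the product of two perfect squares; the door of the route may be fed by ONE descent over `K` for two curves.

Nothing here proves T, O or BSD; T stays conjecture-grade at analytic rank ≥ 2. At `q = 2` the splitting fails and
nothing is claimed beyond the corank identity of `…BaseChange`.

## References

* T. Dokchitser, V. Dokchitser, On the Birch–Swinnerton-Dyer quotients modulo squares, Ann. of Math. 172 (2010),
  Lemma 4.14 (proof). [DokchitserDokchitserAnnals2010]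
* J. W. S. Cassels, Arithmetic on curves of genus 1. IV, J. reine angew. Math. 211 (1962), Thm. 1.1. [Cassels1962ArithmeticIV]
* T. Dokchitser, Notes on the parity conjecture (2013), §2, §4. [Dokchitser2013ParityNotes]
-/

-- D-0017: single-problem summit, so `Summit.BirchSwinnertonDyer.BirchSwinnertonDyer.…` repeats a namespace BY DESIGN.
set_option linter.dupNamespace false
set_option autoImplicit false

noncomputable section

open scoped Classical
open scoped AddSubgroup
open Literature.NumberTheory.EllipticCurves WeierstrassCurve
open Summit.BirchSwinnertonDyer.BirchSwinnertonDyer.Theses.ShaPrimaryTransfer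
open Summit.BirchSwinnertonDyer.BirchSwinnertonDyer.Theorems.ShaPrimaryTransferBaseChange
open Summit.BirchSwinnertonDyer.BirchSwinnertonDyer.Theorems.ShaPrimaryTransferOddDoor

namespace Summit.BirchSwinnertonDyer.BirchSwinnertonDyer.Theorems.ShaPrimaryTransferBaseChangeDescent

variable (W : WeierstrassCurve ℚ) [W.IsElliptic] (K : Type) [Field K] [NumberField K]
  (q : ℕ) [hq : Fact q.Prime]

/-! ## §1 A closed first descent over `K` is two closed first descents over `ℚ` -/

/-- **One closed `q`-descent over `K` = two closed `q`-descents over `ℚ`** (`q` odd, `K` quadratic of discriminant `d_K`):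
`#Ш(E_K)[q] = 1 ⟺ #Ш(E)[q] = 1 ∧ #Ш(E^{(d_K)})[q] = 1`. [cite: DokchitserDokchitserAnnals2010, Lemma 4.14 (proof)] -/
theorem natCard_sha_torsionBy_baseChange_eq_one_iff (h2 : Module.finrank ℚ K = 2) (hq2 : q ≠ 2) :
    Nat.card ((W.baseChange K).sha[(q : ℤ)]) = 1 ↔
      Nat.card (W.sha[(q : ℤ)]) = 1 ∧ Nat.card ((W.quadraticTwist (NumberField.discr K : ℚ)).sha[(q : ℤ)]) = 1 := by
  rw [natCard_sha_torsionBy_baseChange_quadratic_discr_of_odd W K h2 q hq2, mul_eq_one]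

/-- **A closed first `q`-descent over `K` closes BOTH `ℚ`-doors at `q`** (`q` odd): `#Ш(E_K)[q] = 1 ⟹ t_q(E) = 0` and
`t_q(E^{(d_K)}) = 0` (and both `ℚ`-side `q`-descents are closed). [cite: DokchitserDokchitserAnnals2010, Lemma 4.14 (proof)] -/
theorem shaCorank_eq_zero_and_of_natCard_sha_torsionBy_baseChange_eq_one (h2 : Module.finrank ℚ K = 2) (hq2 : q ≠ 2)
    (h1 : Nat.card ((W.baseChange K).sha[(q : ℤ)]) = 1) :
    W.shaCorank q = 0 ∧ (W.quadraticTwist (NumberField.discr K : ℚ)).shaCorank q = 0 := by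
  have hd : ((NumberField.discr K : ℤ) : ℚ) ≠ 0 := by exact_mod_cast NumberField.discr_ne_zero K
  haveI : (W.quadraticTwist (NumberField.discr K : ℚ)).IsElliptic := W.isElliptic_quadraticTwist hd
  obtain ⟨hE, hEd⟩ := (natCard_sha_torsionBy_baseChange_eq_one_iff W K q h2 hq2).mp h1
  exact ⟨shaCorank_eq_zero_of_natCard_sha_torsionBy_eq_one W q hE,
    shaCorank_eq_zero_of_natCard_sha_torsionBy_eq_one (W.quadraticTwist (NumberField.discr K : ℚ)) q hEd⟩

/-- **The defect over `K` is non-trivial iff one of the two `ℚ`-defects is** (`q` odd).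
[cite: DokchitserDokchitserAnnals2010, Lemma 4.14 (proof)] -/
theorem natCard_sha_torsionBy_baseChange_ne_one_iff (h2 : Module.finrank ℚ K = 2) (hq2 : q ≠ 2) :
    Nat.card ((W.baseChange K).sha[(q : ℤ)]) ≠ 1 ↔
      Nat.card (W.sha[(q : ℤ)]) ≠ 1 ∨ Nat.card ((W.quadraticTwist (NumberField.discr K : ℚ)).sha[(q : ℤ)]) ≠ 1 := by
  rw [Ne, natCard_sha_torsionBy_baseChange_eq_one_iff W K q h2 hq2, not_and_or]

/-! ## §2 Exponents add; an odd exponent over `K` locates an infinite `Ш[q^∞]` over `ℚ` -/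

/-- **Exponents add**: `#Ш(E)[q] = q^a`, `#Ш(E^{(d_K)})[q] = q^b` ⟹ `#Ш(E_K)[q] = q^{a+b}` (`q` odd).
[cite: DokchitserDokchitserAnnals2010, Lemma 4.14 (proof)] -/
theorem natCard_sha_torsionBy_baseChange_eq_pow_add (h2 : Module.finrank ℚ K = 2) (hq2 : q ≠ 2) {a b : ℕ}
    (ha : Nat.card (W.sha[(q : ℤ)]) = q ^ a) (hb : Nat.card ((W.quadraticTwist (NumberField.discr K : ℚ)).sha[(q : ℤ)]) = q ^ b) :
    Nat.card ((W.baseChange K).sha[(q : ℤ)]) = q ^ (a + b) := by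
  rw [natCard_sha_torsionBy_baseChange_quadratic_discr_of_odd W K h2 q hq2, ha, hb, pow_add]

/-- **Parities of the two `ℚ`-coranks from the two `ℚ`-defects** (the odd door over `ℚ`, twice): with `#Ш(E)[q] = q^a` and
`#Ш(E^{(d_K)})[q] = q^b`, `t_q(E) ≡ a`, `t_q(E^{(d_K)}) ≡ b` and `t_q(E_K) ≡ a + b (mod 2)`.
[cite: Cassels1962ArithmeticIV, Thm. 1.1] [cite: Dokchitser2013ParityNotes, §2 and §4] -/
theorem shaCorank_mod_two_of_defects (h2 : Module.finrank ℚ K = 2) {a b : ℕ} (ha : Nat.card (W.sha[(q : ℤ)]) = q ^ a)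
    (hb : Nat.card ((W.quadraticTwist (NumberField.discr K : ℚ)).sha[(q : ℤ)]) = q ^ b) :
    W.shaCorank q % 2 = a % 2 ∧ (W.quadraticTwist (NumberField.discr K : ℚ)).shaCorank q % 2 = b % 2 ∧
      (W.baseChange K).shaCorank q % 2 = (a + b) % 2 := by
  have hd : ((NumberField.discr K : ℤ) : ℚ) ≠ 0 := by exact_mod_cast NumberField.discr_ne_zero K
  haveI : (W.quadraticTwist (NumberField.discr K : ℚ)).IsElliptic := W.isElliptic_quadraticTwist hd
  have h1 := shaCorank_mod_two_eq W q ha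
  have h2' := shaCorank_mod_two_eq (W.quadraticTwist (NumberField.discr K : ℚ)) q hb
  refine ⟨h1, h2', ?_⟩
  rw [shaCorank_baseChange_quadratic W K q h2]
  omega

/-- **An odd exponent on the `E`-side opens the `ℚ`-door of `E`**: `#Ш(E)[q] = q^a` with `a` odd ⟹ `t_q(E) ≥ 1` and
`t_q(E_K) ≥ 1` (the infinite `Ш(E)[q^∞]` survives in `Ш(E_K)[q^∞]`). [cite: Cassels1962ArithmeticIV, Thm. 1.1]
[cite: Dokchitser2013ParityNotes, §2] -/
theorem one_le_shaCorank_and_baseChange_of_odd_exponent {a : ℕ} (ha : Nat.card (W.sha[(q : ℤ)]) = q ^ a)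
    (hodd : Odd a) : 1 ≤ W.shaCorank q ∧ 1 ≤ (W.baseChange K).shaCorank q := by
  have h1 : 1 ≤ W.shaCorank q := (odd_shaCorank_of_natCard_eq_pow_odd W q ha hodd).pos
  exact ⟨h1, one_le_shaCorank_baseChange_of_one_le W K q h1⟩

/-- **An odd exponent of the `K`-defect locates an infinite `Ш[q^∞]` over `ℚ`**: one `ℚ`-side exponent is odd, and that
side has positive corank (`q` odd): if `#Ш(E)[q] = q^a`, `#Ш(E^{(d_K)})[q] = q^b` and `a + b` is odd, then `a` is odd and `t_q(E) ≥ 1`, or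
`b` is odd and `t_q(E^{(d_K)}) ≥ 1`. [cite: Cassels1962ArithmeticIV, Thm. 1.1] [cite: Dokchitser2013ParityNotes, §2 and §4] -/
theorem odd_and_one_le_shaCorank_or_of_odd_add {a b : ℕ} (ha : Nat.card (W.sha[(q : ℤ)]) = q ^ a)
    (hb : Nat.card ((W.quadraticTwist (NumberField.discr K : ℚ)).sha[(q : ℤ)]) = q ^ b) (hodd : Odd (a + b)) :
    (Odd a ∧ 1 ≤ W.shaCorank q) ∨ (Odd b ∧ 1 ≤ (W.quadraticTwist (NumberField.discr K : ℚ)).shaCorank q) := by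
  have hd : ((NumberField.discr K : ℤ) : ℚ) ≠ 0 := by exact_mod_cast NumberField.discr_ne_zero K
  haveI : (W.quadraticTwist (NumberField.discr K : ℚ)).IsElliptic := W.isElliptic_quadraticTwist hd
  rcases Nat.even_or_odd b with hb2 | hb2
  · have ha2 : Odd a := (Nat.odd_add.mp hodd).mpr hb2
    exact Or.inl ⟨ha2, (odd_shaCorank_of_natCard_eq_pow_odd W q ha ha2).pos⟩
  · exact Or.inr ⟨hb2, (odd_shaCorank_of_natCard_eq_pow_odd (W.quadraticTwist (NumberField.discr K : ℚ)) q hb hb2).pos⟩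

/-! ## §3 Route readings -/

/-- **Granting T, one closed door of `E` (at `p`) and one of `E^{(d_K)}` (at `p'`) make every odd-`q` defect of `E_K` a
product of two perfect squares** — the two `ℚ`-defects (T moves both doors to `q`; the odd door over `ℚ` squares each;
the splitting multiplies them). [cite: Cassels1962ArithmeticIV, Thm. 1.1] [cite: DokchitserDokchitserAnnals2010, Lemma 4.14 (proof)] -/
theorem natCard_sha_torsionBy_baseChange_eq_mul_squares_of_transfer (hT : FiniteShaComponentTransfer)
    (h2 : Module.finrank ℚ K = 2) (hq2 : q ≠ 2) (p p' : ℕ) [Fact p.Prime] [Fact p'.Prime] (hE : W.shaCorank p = 0)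
    (hEd : (W.quadraticTwist (NumberField.discr K : ℚ)).shaCorank p' = 0) :
    Nat.card ((W.baseChange K).sha[(q : ℤ)]) =
        Nat.card (W.sha[(q : ℤ)]) * Nat.card ((W.quadraticTwist (NumberField.discr K : ℚ)).sha[(q : ℤ)]) ∧
      IsSquare (Nat.card (W.sha[(q : ℤ)])) ∧
        IsSquare (Nat.card ((W.quadraticTwist (NumberField.discr K : ℚ)).sha[(q : ℤ)])) := by
  have hd : ((NumberField.discr K : ℤ) : ℚ) ≠ 0 := by exact_mod_cast NumberField.discr_ne_zero K
  haveI : (W.quadraticTwist (NumberField.discr K : ℚ)).IsElliptic := W.isElliptic_quadraticTwist hd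
  exact ⟨natCard_sha_torsionBy_baseChange_quadratic_discr_of_odd W K h2 q hq2,
    isSquare_natCard_sha_torsionBy_of_shaCorank_eq_zero W q (hT W p q hE),
    isSquare_natCard_sha_torsionBy_of_shaCorank_eq_zero (W.quadraticTwist (NumberField.discr K : ℚ)) q
      (hT (W.quadraticTwist (NumberField.discr K : ℚ)) p' q hEd)⟩

/-- **The route's door fed by ONE descent over `K` for TWO curves**: a closed first `q`-descent over `K` (`q` odd)
gives the door O at `q` for `E` and for `E^{(d_K)}`; granting T, every door of `E`, of `E^{(d_K)}` and of `E_K` is then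
closed. [cite: DokchitserDokchitserAnnals2010, Lemma 4.14 (proof)] -/
theorem forall_shaCorank_eq_zero_of_transfer_of_natCard_sha_torsionBy_baseChange_eq_one
    (hT : FiniteShaComponentTransfer) (h2 : Module.finrank ℚ K = 2) (hq2 : q ≠ 2)
    (h1 : Nat.card ((W.baseChange K).sha[(q : ℤ)]) = 1) (r : ℕ) [Fact r.Prime] :
    W.shaCorank r = 0 ∧ (W.quadraticTwist (NumberField.discr K : ℚ)).shaCorank r = 0 ∧
      (W.baseChange K).shaCorank r = 0 := by
  have hK : (W.baseChange K).shaCorank q = 0 :=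
    (shaCorank_baseChange_eq_zero_iff W K q h2).mpr
      (shaCorank_eq_zero_and_of_natCard_sha_torsionBy_baseChange_eq_one W K q h2 hq2 h1)
  exact forall_shaCorank_eq_zero_of_transfer_of_baseChange_quadratic hT W K h2 q hK r

end Summit.BirchSwinnertonDyer.BirchSwinnertonDyer.Theorems.ShaPrimaryTransferBaseChangeDescent

end
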